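import Summits.QuantumFields.BalabanUV.T4Continuum.Support.NE7StraightDefectInner
import Summits.QuantumFields.BalabanUV.T4Continuum.Support.NE7HessFlatCutoffLeibniz
import HarnessLib

/-!
# NE7StraightDefectAssemblyV2 — THE TWO-REGION CRITICALITY DEFECT OF THE TORUS ROAD v4 ON STRAIGHT TANGENTS, REPAIRED ((N2)-hess): for the CUT-OFF
# representative `g•Ã` (`Ã` skew periodic with `‖Ã‖ ≤ α₀`, lattice differences `≤ α₁`, F51's budgets on `Mα₀`, agreeing with a TANGENT-CRITICAL `U′` near
# `supp g`; `g ∈ [0,1]` periodic with first∕second lattice differences `≤ c₁ ∕ c₂`, varying only inside the far set `S` together with its neighbours), every skew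
# periodic STRAIGHT tangent `Y` has `|dAction_{e^{g•Ã}} Y| ≤ τn·‖Y‖_{1,near} + τf·‖Y‖_{1,far}` with `τn = c_R·C₅₁ + ρ(α₀,α₁) + ρ(α₀,α₁+c₁α₀)` and
# `τf = τn + c_R·q^{k+1} + 2#Plane(2c₁α₁ + c₂α₀)` — EVERY term `O(M⁻³)` in the road's currencies (no `4#Plane·α₁`)

Cell `pub-balaban`, rung (B)+1 sub-cell t4, lineage `b2b-balaban-t4-ne7-p1` (CRUX PROVER NE7 #1 = OWNER of row NE7), generation 90; memo
`t4/b2b-balaban-t4-ne7-p1-g90/DEFECT-FAR.md` §1–§3.  File F275 (over F273 `NE7HessFlatCutoffLeibniz.abs_hess_flat_weight_sub_le`, F274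
`NE7StraightDefectInner.abs_dAction_weight_le_inner_straight`, F48b `NE7ExpansionRemainderFlat.abs_dAction_vary_sub_hess_flat_le` twice).

WHY (memo §1).  F268 supplied F263's defect clause with `τf ∋ 4#Plane·α₁ ≍ r∕M²`, one power of `M` short for the line `K·M·e^{−cℓ}·τf ≤ θr∕M²` at fixed `N`.  The repair:
`dAction_{e^{g•Ã}} Y ≈ hess_1(g•Ã, Y)` (EXP, density `ρ(α₀, α₁ + c₁α₀)`), `hess_1(g•Ã, Y) = hess_1(Ã, g•Y) + commutators` (F273: density `2#Plane(2c₁α₁ + c₂α₀)` on `S`),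
`hess_1(Ã, g•Y) ≈ dAction_{e^{Ã}}(g•Y)` (EXP, density `ρ(α₀,α₁)`), and `dAction_{e^{Ã}}(g•Y)` through criticality (F274: `c_R·C₅₁‖Y‖₁ + c_R q^{k+1}‖Y‖_{1,S}`).  With
`α₀ ≍ R r∕M`, `α₁ ≍ R r∕M²`, `c₁ ≍ 1∕(RM)`, `c₂ ≍ 1∕(RM)²`, `c_R ∝ a = r∕M²`: every density is `O(r·r_tot∕M³)` or `O(r∕M³)` (the latter only on `S`, discounted by `e^{−cℓ}`).
WHAT ([folklore] composition; 0 def, 0 sorry; generic `d`, `L ≥ 2`).  **`abs_dAction_cutoffRep_le_twoRegion_straight`** (statement spelled in full below).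
HONEST FRAMING (page 1): composition BY NAME of tree theorems; the chart (N1)-weak is NOT supplied here (it is the agreement hypothesis); nothing of Bałaban's asserted;
NOT (APE), NOT ONE-STEP, NOT NE7; spine 0∕9; finite T⁴ rung (B)+1 — NOT infinite volume, NOT mass gap, NOT `BetaPertH`, NOT Clay.  Continuum YM on T⁴ ⇐ BetaPertH ∧
nine spine estimates (0/9 proved); BetaPertH ⇐ (D1) ∧ (D4) ∧ CAP+tail; G-an2-4 gates asym, D1 and NE2/3/4.
-/

set_option autoImplicit false

open scoped BigOperators Matrix.Norms.L2Operator
open NormedSpace Finset Set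

namespace Summit.QuantumFields.BalabanUV.T4Continuum.NE7StraightDefectAssemblyV2

open Literature.MathematicalPhysics.QuantumFieldTheory.Balaban1983to89
open B7Prop1Explicit B7Prop2Explicit MatrixLog UnitaryModel
open T4AveragingDeficitWall (IsUnitaryCfg IsSkewDir SmallField vary dirL1)
open T4AveragingDeficitWallBoundary (IsPeriodicCfg periodBox)
open AveragingDeficitPeriodicCounting (IsPeriodicDir)
open AveragingDeficitMultiLevelPrep (LevelSmall)
open BlockAverageVaryHolo (nbRad)
open BlockAverageVaryDisc (rho0)
open MinimalActionLevels (perWin)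
open NE3HessForm (dAction)
open BlockAveragePushDirSplit (flat)
open NE3TangentFlatStructure (Qcoarse)
open NE3TangentCovariantTower (dirIter)
open NE3LinearisedAverageSup (curvSum)
open NE3QbarIterCovLiftPrep (cruxC)
open NE3RightInverseSolveLetters (thetaLoc)
open NE3HatInvCurlLetters (curl1C curl1C_nonneg)
open NE3HessForm (hess)
open NE7ExpansionRemainderFlat (abs_dAction_vary_sub_hess_flat_le)
open NE7HessFlatCutoffLeibniz (abs_hess_flat_weight_sub_le)
open NE7StraightDefectInner (abs_dAction_weight_le_inner_straight)

noncomputable section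

variable {d : ℕ} {n : Type*} [Fintype n] [DecidableEq n]

/-- **THE TWO-REGION CRITICALITY DEFECT OF THE CUT-OFF REPRESENTATIVE ON STRAIGHT TANGENTS** (`M = L^{k+1}`, period `P = M·N`, `q = L∕L^d`; statement in the
module docstring).  Hypotheses: F274's (the tangent-critical `U′` of the multi-level class; `Ã` skew periodic, `‖Ã‖ ≤ α₀`, F51's budgets; the weight `g ∈ [0,1]`, the
far set `S`, the slab dichotomy, the two agreement clauses) plus: lattice differences of `Ã` `≤ α₁`; `|δg| ≤ c₁`, `|δ²g| ≤ c₂`; wherever `g` varies along a bond out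
of `z`, `z ∈ S` and every `z + e_λ ∈ S`.  Conclusion: for every skew `P`-periodic straight tangent `Y`,
`|dAction (e^{g•Ã}) Y (perWin d P)| ≤ τn·‖Y‖_{ℓ¹(periodBox P ∖ S)} + τf·‖Y‖_{ℓ¹(periodBox P ∩ S)}`. [folklore] -/
theorem abs_dAction_cutoffRep_le_twoRegion_straight [Nonempty n] {L : ℕ} (hL : 2 ≤ L) (k : ℕ) {N : ℕ} [NeZero N]
    -- the tangent-critical gauge-fixed configuration `U′`
    {U' : Site d → Fin d → (Matrix n n ℂ)ˣ} {x a : ℝ}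
    (hU'u : IsUnitaryCfg U') (hU'P : IsPeriodicCfg U' ((L ^ (k + 1) * N : ℕ) : ℤ)) (hx : 0 ≤ x) (hs : LevelSmall d L k x) (hU'x : SmallField U' x)
    (hθ : cruxC d L * (((L : ℝ) ^ (k + 1)) ^ 2 * x) < 1) (hθl : thetaLoc d L * (((L : ℝ) ^ (k + 1)) ^ 2 * x) < 1)
    (hε : ((L : ℝ) ^ (k + 1)) ^ 2 * x ≤ 1) (ha : 0 ≤ a) (hU'a : SmallField U' a)
    (hcrit : ∀ Y' : Site d → Fin d → Matrix n n ℂ, IsSkewDir Y' → IsPeriodicDir Y' ((L ^ (k + 1) * N : ℕ) : ℤ) →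
      dirIter L (k + 1) U' Y' = 0 → dAction U' Y' (perWin d (L ^ (k + 1) * N)) = 0)
    -- the global representative `e^{Ã}`
    {A : Site d → Fin d → Matrix n n ℂ} (hA : IsSkewDir A) (hAP : IsPeriodicDir A ((L ^ (k + 1) * N : ℕ) : ℤ))
    {α₀ α₁ : ℝ} (hα₀ : 0 ≤ α₀) (hα₁ : 0 ≤ α₁) (hAα : ∀ (y : Site d) (μ : Fin d), ‖A y μ‖ ≤ α₀)
    (hA1 : ∀ (y : Site d) (κ τ : Fin d), ‖A (y + e τ) κ - A y κ‖ ≤ α₁)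
    (hs0 : LevelSmall d L (k + 1) 0) (hcurv : curvSum d L (k + 1) 0 ≤ 2 / 3 * L)
    (hσ : 4 * (3 + 12 * (d : ℝ)) ^ 2 * (L : ℝ) ^ (k + 1) * α₀ ≤ rho0 d L ^ 2)
    (hS1 : (8 * (3 + 12 * (d : ℝ)) * (2 + 2 * (((d : ℝ) + 1) * L)
        * (1 + ((1250 * ((nbRad d L : ℝ) + L) + 8 * (d * L) + 2 * L) * (d * (2 * nbRad d L + 1) ^ d)) / ((L : ℝ) / (L : ℝ) ^ d))))
        * ((L : ℝ) ^ (k + 1) * α₀) ≤ 1)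
    (hb : 256 * ((d : ℝ) + 1) * L * (3 + 12 * (d : ℝ)) * ((L : ℝ) ^ (k + 1) * α₀) ≤ 1)
    -- the cutoff weight and the far region
    (g : Site d → ℝ) (hgP : ∀ (y : Site d) (i : Fin d), g (y + ((L ^ (k + 1) * N : ℕ) : ℤ) • e i) = g y) (hg01 : ∀ y : Site d, 0 ≤ g y ∧ g y ≤ 1)
    {c₁ c₂ : ℝ} (hc₁ : 0 ≤ c₁) (hc₂ : 0 ≤ c₂) (hg1 : ∀ (z : Site d) (κ : Fin d), |g (z + e κ) - g z| ≤ c₁)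
    (hg2 : ∀ (z : Site d) (κ τ : Fin d), |(g (z + e κ) - g z) - (g (z - e τ + e κ) - g (z - e τ))| ≤ c₂)
    (S : Site d → Prop) [DecidablePred S] (hSP : ∀ (y : Site d) (i : Fin d), S (y + ((L ^ (k + 1) * N : ℕ) : ℤ) • e i) ↔ S y)
    (hgS : ∀ (z : Site d) (κ : Fin d), g (z + e κ) ≠ g z → S z ∧ ∀ lam : Fin d, S (z + e lam))
    (hbox : ∀ (w : Site d) (τ : Fin d),
      (∃ g₀ : ℝ, ∀ y : Site d, (∀ i, (L : ℤ) ^ (k + 1) * w i ≤ y i ∧ y i ≤ (L : ℤ) ^ (k + 1) * w i + 2 * (L : ℤ) ^ (k + 1) - 1) → g y = g₀)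
      ∨ (∀ y : Site d, (∀ i, (L : ℤ) ^ (k + 1) * w i ≤ y i ∧ y i ≤ (L : ℤ) ^ (k + 1) * w i + 2 * (L : ℤ) ^ (k + 1) - 1) → S y))
    (hagreeQ : ∀ (w : Site d) (τ : Fin d),
      (∃ y₀ : Site d, (∀ i, (L : ℤ) ^ (k + 1) * w i ≤ y₀ i ∧ y₀ i ≤ (L : ℤ) ^ (k + 1) * w i + 2 * (L : ℤ) ^ (k + 1) - 1) ∧ g y₀ ≠ 0) →
      ∀ (y : Site d) (μ : Fin d), (∀ i, (L : ℤ) ^ (k + 1) * w i ≤ y i ∧ y i ≤ (L : ℤ) ^ (k + 1) * w i + 2 * (L : ℤ) ^ (k + 1) - 1) →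
        U' y μ = vary (flat (d := d) (n := n)) A 1 y μ)
    (hagreeP : ∀ (z : Site d) (μ ν : Fin d), (g z ≠ 0 ∨ g (z + e μ) ≠ 0 ∨ g (z + e ν) ≠ 0) →
      vary (flat (d := d) (n := n)) A 1 z μ = U' z μ ∧ vary (flat (d := d) (n := n)) A 1 (z + e μ) ν = U' (z + e μ) ν ∧
      vary (flat (d := d) (n := n)) A 1 (z + e ν) μ = U' (z + e ν) μ ∧ vary (flat (d := d) (n := n)) A 1 z ν = U' z ν)
    -- the straight tangent
    {Y : Site d → Fin d → Matrix n n ℂ} (hY : IsSkewDir Y) (hYP : IsPeriodicDir Y ((L ^ (k + 1) * N : ℕ) : ℤ)) (hYQ : (Qcoarse L)^[k + 1] Y = 0) :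
    |dAction (vary (flat (d := d) (n := n)) (fun y μ => g y • A y μ) 1) Y (perWin d (L ^ (k + 1) * N))|
      ≤ ((a * ((curl1C d L / (1 - thetaLoc d L * (((L : ℝ) ^ (k + 1)) ^ 2 * x))) * (((L : ℝ) ^ (k + 1)) ^ d / ((L : ℝ) ^ (k + 1)) ^ 2))) * (2 * ((8 * (3 + 12 * (d : ℝ)) * (2 + 2 * (((d : ℝ) + 1) * L)
              * (1 + ((1250 * ((nbRad d L : ℝ) + L) + 8 * (d * L) + 2 * L) * (d * (2 * nbRad d L + 1) ^ d)) / ((L : ℝ) / (L : ℝ) ^ d))))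
              * ((L : ℝ) ^ (k + 1) * α₀)) * ((L : ℝ) / (L : ℝ) ^ d) ^ (k + 1))
          + ((Fintype.card (T4AveragingDeficitWall.Plane d) : ℝ)
              * (2 * (8 * α₀ * (2 * α₁ + 28 * α₀ ^ 2) + 6 * (Real.exp α₀ - 1) * (2 * α₁ + 24 * (Real.exp α₀ - 1) * α₀)
                  + (2 * α₁ + 24 * (Real.exp α₀ - 1) * α₀) * (2 * α₁ + 28 * α₀ ^ 2) + 960 * (Real.exp α₀ - 1) * α₀ ^ 2)
                + 64 * α₀ * α₁))
          + ((Fintype.card (T4AveragingDeficitWall.Plane d) : ℝ)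
              * (2 * (8 * α₀ * (2 * (α₁ + c₁ * α₀) + 28 * α₀ ^ 2) + 6 * (Real.exp α₀ - 1) * (2 * (α₁ + c₁ * α₀) + 24 * (Real.exp α₀ - 1) * α₀)
                  + (2 * (α₁ + c₁ * α₀) + 24 * (Real.exp α₀ - 1) * α₀) * (2 * (α₁ + c₁ * α₀) + 28 * α₀ ^ 2) + 960 * (Real.exp α₀ - 1) * α₀ ^ 2)
                + 64 * α₀ * (α₁ + c₁ * α₀))))
          * dirL1 Y ((periodBox (d := d) (L ^ (k + 1) * N)).filter (fun y => ¬ S y))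
        + (((a * ((curl1C d L / (1 - thetaLoc d L * (((L : ℝ) ^ (k + 1)) ^ 2 * x))) * (((L : ℝ) ^ (k + 1)) ^ d / ((L : ℝ) ^ (k + 1)) ^ 2))) * (2 * ((8 * (3 + 12 * (d : ℝ)) * (2 + 2 * (((d : ℝ) + 1) * L)
              * (1 + ((1250 * ((nbRad d L : ℝ) + L) + 8 * (d * L) + 2 * L) * (d * (2 * nbRad d L + 1) ^ d)) / ((L : ℝ) / (L : ℝ) ^ d))))
              * ((L : ℝ) ^ (k + 1) * α₀)) * ((L : ℝ) / (L : ℝ) ^ d) ^ (k + 1))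
          + ((Fintype.card (T4AveragingDeficitWall.Plane d) : ℝ)
              * (2 * (8 * α₀ * (2 * α₁ + 28 * α₀ ^ 2) + 6 * (Real.exp α₀ - 1) * (2 * α₁ + 24 * (Real.exp α₀ - 1) * α₀)
                  + (2 * α₁ + 24 * (Real.exp α₀ - 1) * α₀) * (2 * α₁ + 28 * α₀ ^ 2) + 960 * (Real.exp α₀ - 1) * α₀ ^ 2)
                + 64 * α₀ * α₁))
          + ((Fintype.card (T4AveragingDeficitWall.Plane d) : ℝ)
              * (2 * (8 * α₀ * (2 * (α₁ + c₁ * α₀) + 28 * α₀ ^ 2) + 6 * (Real.exp α₀ - 1) * (2 * (α₁ + c₁ * α₀) + 24 * (Real.exp α₀ - 1) * α₀)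
                  + (2 * (α₁ + c₁ * α₀) + 24 * (Real.exp α₀ - 1) * α₀) * (2 * (α₁ + c₁ * α₀) + 28 * α₀ ^ 2) + 960 * (Real.exp α₀ - 1) * α₀ ^ 2)
                + 64 * α₀ * (α₁ + c₁ * α₀))))
          + (a * ((curl1C d L / (1 - thetaLoc d L * (((L : ℝ) ^ (k + 1)) ^ 2 * x))) * (((L : ℝ) ^ (k + 1)) ^ d / ((L : ℝ) ^ (k + 1)) ^ 2))) * ((L : ℝ) / (L : ℝ) ^ d) ^ (k + 1)
          + 2 * (Fintype.card (T4AveragingDeficitWall.Plane d) : ℝ) * (2 * c₁ * α₁ + c₂ * α₀))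
          * dirL1 Y ((periodBox (d := d) (L ^ (k + 1) * N)).filter (fun y => S y)) := by
  classical
  have hP1 : 1 ≤ L ^ (k + 1) * N := Nat.one_le_iff_ne_zero.mpr (Nat.mul_ne_zero (pow_ne_zero _ (by omega)) (NeZero.ne N))
  -- abbreviations
  obtain ⟨cR, hcR⟩ : ∃ c : ℝ, c = (a * ((curl1C d L / (1 - thetaLoc d L * (((L : ℝ) ^ (k + 1)) ^ 2 * x))) * (((L : ℝ) ^ (k + 1)) ^ d / ((L : ℝ) ^ (k + 1)) ^ 2))) := ⟨_, rfl⟩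
  obtain ⟨C51, hC51⟩ : ∃ c : ℝ, c = (2 * ((8 * (3 + 12 * (d : ℝ)) * (2 + 2 * (((d : ℝ) + 1) * L)
              * (1 + ((1250 * ((nbRad d L : ℝ) + L) + 8 * (d * L) + 2 * L) * (d * (2 * nbRad d L + 1) ^ d)) / ((L : ℝ) / (L : ℝ) ^ d))))
              * ((L : ℝ) ^ (k + 1) * α₀)) * ((L : ℝ) / (L : ℝ) ^ d) ^ (k + 1)) := ⟨_, rfl⟩
  obtain ⟨q, hq⟩ : ∃ c : ℝ, c = ((L : ℝ) / (L : ℝ) ^ d) ^ (k + 1) := ⟨_, rfl⟩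
  obtain ⟨ρ, hρ⟩ : ∃ c : ℝ, c = ((Fintype.card (T4AveragingDeficitWall.Plane d) : ℝ)
              * (2 * (8 * α₀ * (2 * α₁ + 28 * α₀ ^ 2) + 6 * (Real.exp α₀ - 1) * (2 * α₁ + 24 * (Real.exp α₀ - 1) * α₀)
                  + (2 * α₁ + 24 * (Real.exp α₀ - 1) * α₀) * (2 * α₁ + 28 * α₀ ^ 2) + 960 * (Real.exp α₀ - 1) * α₀ ^ 2)
                + 64 * α₀ * α₁)) := ⟨_, rfl⟩
  obtain ⟨ρ', hρ'⟩ : ∃ c : ℝ, c = ((Fintype.card (T4AveragingDeficitWall.Plane d) : ℝ)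
              * (2 * (8 * α₀ * (2 * (α₁ + c₁ * α₀) + 28 * α₀ ^ 2) + 6 * (Real.exp α₀ - 1) * (2 * (α₁ + c₁ * α₀) + 24 * (Real.exp α₀ - 1) * α₀)
                  + (2 * (α₁ + c₁ * α₀) + 24 * (Real.exp α₀ - 1) * α₀) * (2 * (α₁ + c₁ * α₀) + 28 * α₀ ^ 2) + 960 * (Real.exp α₀ - 1) * α₀ ^ 2)
                + 64 * α₀ * (α₁ + c₁ * α₀))) := ⟨_, rfl⟩
  obtain ⟨Cm, hCm⟩ : ∃ c : ℝ, c = 2 * (Fintype.card (T4AveragingDeficitWall.Plane d) : ℝ) * (2 * c₁ * α₁ + c₂ * α₀) := ⟨_, rfl⟩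
  rw [← hC51, ← hcR, ← hq, ← hρ, ← hρ', ← hCm]
  -- the regions
  set Bn : Finset (Site d) := (periodBox (d := d) (L ^ (k + 1) * N)).filter (fun y => ¬ S y) with hBn
  set Bf : Finset (Site d) := (periodBox (d := d) (L ^ (k + 1) * N)).filter (fun y => S y) with hBf
  have hnear0 : 0 ≤ dirL1 Y Bn := Finset.sum_nonneg fun _ _ => Finset.sum_nonneg fun _ _ => norm_nonneg _
  have hfar0 : 0 ≤ dirL1 Y Bf := Finset.sum_nonneg fun _ _ => Finset.sum_nonneg fun _ _ => norm_nonneg _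
  have hsplitY : dirL1 Y (periodBox (d := d) (L ^ (k + 1) * N)) = dirL1 Y Bf + dirL1 Y Bn := by
    unfold dirL1
    rw [hBf, hBn, Finset.sum_filter_add_sum_filter_not]
  -- the cut-off representative `A′ = g•Ã` and its letters
  set A' : Site d → Fin d → Matrix n n ℂ := fun y μ => g y • A y μ with hA'
  have hA's : IsSkewDir A' := fun y μ => skewAdjoint.smul_mem (g y) (hA y μ)
  have hA'P : IsPeriodicDir A' ((L ^ (k + 1) * N : ℕ) : ℤ) := fun y i μ => by simp only [hA', hgP y i, hAP y i μ]
  have hg1' : ∀ y : Site d, |g y| ≤ 1 := fun y => abs_le.mpr ⟨by linarith [(hg01 y).1], (hg01 y).2⟩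
  have hA'α : ∀ (y : Site d) (μ : Fin d), ‖A' y μ‖ ≤ α₀ := by
    intro y μ
    show ‖g y • A y μ‖ ≤ α₀
    rw [norm_smul, Real.norm_eq_abs]
    calc |g y| * ‖A y μ‖ ≤ 1 * α₀ := mul_le_mul (hg1' y) (hAα y μ) (norm_nonneg _) zero_le_one
      _ = α₀ := one_mul _
  have hα₁' : 0 ≤ α₁ + c₁ * α₀ := by positivity
  have hA'1 : ∀ (y : Site d) (κ τ : Fin d), ‖A' (y + e τ) κ - A' y κ‖ ≤ α₁ + c₁ * α₀ := by
    intro y κ τ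
    show ‖g (y + e τ) • A (y + e τ) κ - g y • A y κ‖ ≤ _
    have e1 : g (y + e τ) • A (y + e τ) κ - g y • A y κ = g (y + e τ) • (A (y + e τ) κ - A y κ) + (g (y + e τ) - g y) • A y κ := by
      simp only [smul_sub, sub_smul]; abel
    rw [e1]
    refine (norm_add_le _ _).trans (add_le_add ?_ ?_)
    · rw [norm_smul, Real.norm_eq_abs]
      calc |g (y + e τ)| * ‖A (y + e τ) κ - A y κ‖ ≤ 1 * α₁ := mul_le_mul (hg1' _) (hA1 y κ τ) (norm_nonneg _) zero_le_one
        _ = α₁ := one_mul _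
    · rw [norm_smul, Real.norm_eq_abs]
      exact mul_le_mul (hg1 y τ) (hAα y κ) (norm_nonneg _) hc₁
  -- (1) EXP for `A′` against `Y`
  have hEXP' := abs_dAction_vary_sub_hess_flat_le hP1 hA's hA'P hα₀ hα₁' hA'α hA'1 hY hYP
  rw [← hρ'] at hEXP'
  -- (2) the cutoff Leibniz rule (F273), variation zone inside `S`
  have hLeib := abs_hess_flat_weight_sub_le (n := n) hP1 g hgP hc₁ hc₂ hg1 hg2 S hSP hgS hAP hYP hα₀ hα₁ hAα hA1
  rw [← hCm] at hLeib
  -- (3) EXP for `Ã` against `g•Y`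
  have hgY_s : IsSkewDir (fun y μ => g y • Y y μ) := fun y μ => skewAdjoint.smul_mem (g y) (hY y μ)
  have hgY_P : IsPeriodicDir (fun y μ => g y • Y y μ) ((L ^ (k + 1) * N : ℕ) : ℤ) := fun y i μ => by simp only [hgP y i, hYP y i μ]
  have hEXP := abs_dAction_vary_sub_hess_flat_le hP1 hA hAP hα₀ hα₁ hAα hA1 hgY_s hgY_P
  rw [← hρ] at hEXP
  have hgY_l1 : dirL1 (fun y μ => g y • Y y μ) (periodBox (d := d) (L ^ (k + 1) * N)) ≤ dirL1 Y (periodBox (d := d) (L ^ (k + 1) * N)) := by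
    unfold dirL1
    refine Finset.sum_le_sum fun y _ => Finset.sum_le_sum fun μ _ => ?_
    show ‖g y • Y y μ‖ ≤ ‖Y y μ‖
    rw [norm_smul, Real.norm_eq_abs]
    exact mul_le_of_le_one_left (norm_nonneg _) (hg1' y)
  -- (4) the inner piece through criticality (F274)
  have hinner := abs_dAction_weight_le_inner_straight (n := n) hL k hU'u hU'P hx hs hU'x hθ hθl hε ha hU'a hcrit hA hAP hα₀ hAα hs0 hcurv hσ hS1 hb
    g hgP hg01 S hSP hbox hagreeQ hagreeP hY hYP hYQ
  rw [← hC51, ← hcR, ← hq] at hinner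
  -- nonnegativity of the densities
  have hδe : 0 ≤ Real.exp α₀ - 1 := by linarith [Real.add_one_le_exp α₀]
  have hρ0 : 0 ≤ ρ := by rw [hρ]; positivity
  have hρ'0 : 0 ≤ ρ' := by rw [hρ']; positivity
  -- assemble
  have hY0 : 0 ≤ dirL1 Y (periodBox (d := d) (L ^ (k + 1) * N)) := Finset.sum_nonneg fun _ _ => Finset.sum_nonneg fun _ _ => norm_nonneg _
  have h1 : |dAction (vary (flat (d := d) (n := n)) A' 1) Y (perWin d (L ^ (k + 1) * N))|
      ≤ |hess (flat (d := d) (n := n)) A' Y (perWin d (L ^ (k + 1) * N))| + ρ' * dirL1 Y (periodBox (d := d) (L ^ (k + 1) * N)) := by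
    have := abs_sub_abs_le_abs_sub (dAction (vary (flat (d := d) (n := n)) A' 1) Y (perWin d (L ^ (k + 1) * N)))
      (hess (flat (d := d) (n := n)) A' Y (perWin d (L ^ (k + 1) * N)))
    linarith
  have h2 : |hess (flat (d := d) (n := n)) A' Y (perWin d (L ^ (k + 1) * N))|
      ≤ |hess (flat (d := d) (n := n)) A (fun y μ => g y • Y y μ) (perWin d (L ^ (k + 1) * N))| + Cm * dirL1 Y Bf := by
    have := abs_sub_abs_le_abs_sub (hess (flat (d := d) (n := n)) A' Y (perWin d (L ^ (k + 1) * N)))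
      (hess (flat (d := d) (n := n)) A (fun y μ => g y • Y y μ) (perWin d (L ^ (k + 1) * N)))
    linarith
  have h3 : |hess (flat (d := d) (n := n)) A (fun y μ => g y • Y y μ) (perWin d (L ^ (k + 1) * N))|
      ≤ |dAction (vary (flat (d := d) (n := n)) A 1) (fun y μ => g y • Y y μ) (perWin d (L ^ (k + 1) * N))|
        + ρ * dirL1 Y (periodBox (d := d) (L ^ (k + 1) * N)) := by
    have := abs_sub_abs_le_abs_sub (hess (flat (d := d) (n := n)) A (fun y μ => g y • Y y μ) (perWin d (L ^ (k + 1) * N)))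
      (dAction (vary (flat (d := d) (n := n)) A 1) (fun y μ => g y • Y y μ) (perWin d (L ^ (k + 1) * N)))
    have hm : ρ * dirL1 (fun y μ => g y • Y y μ) (periodBox (d := d) (L ^ (k + 1) * N)) ≤ ρ * dirL1 Y (periodBox (d := d) (L ^ (k + 1) * N)) :=
      mul_le_mul_of_nonneg_left hgY_l1 hρ0
    rw [abs_sub_comm] at this
    linarith
  rw [hsplitY] at h1 h3 hinner
  calc |dAction (vary (flat (d := d) (n := n)) A' 1) Y (perWin d (L ^ (k + 1) * N))|
      ≤ (cR * C51 * (dirL1 Y Bf + dirL1 Y Bn) + cR * q * dirL1 Y Bf) + ρ * (dirL1 Y Bf + dirL1 Y Bn) + Cm * dirL1 Y Bf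
          + ρ' * (dirL1 Y Bf + dirL1 Y Bn) := by linarith
    _ = (cR * C51 + ρ + ρ') * dirL1 Y Bn + ((cR * C51 + ρ + ρ') + cR * q + Cm) * dirL1 Y Bf := by ring

end

end Summit.QuantumFields.BalabanUV.T4Continuum.NE7StraightDefectAssemblyV2
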